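import Summits.QuantumFields.YangMills.Theorems.BalabanUVNodesK2AtBetaOfRecord13ChainFree
import Summits.QuantumFields.YangMills.Theorems.BalabanUVNodesK2D1StubJetsFree
import Literature.MathematicalPhysics.QuantumFieldTheory.Balaban1983to89.Node00.Record13SepCoPR

/-!
# DAG node N26 ∕ crux K2⁶ — THE THIN `SepCoPR` JUNCTION: the rev-22 item edition's datum `Node00.datumOfRecord₁₃SepCoPR θ (h : θ.Provisos₁₃SepCoPR F N)` (node00-def-T
# FILE 26T `Node00/Record13SepCoPR.lean` p529780 = v1.6 `CoPR`: director-ym №169 H1 ∕ №174 PRESS WORD — FINDING №8, `θ : Stage13RParams` with the run-indexed residual slot `Zr`;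
# β and every Stage-≤13 field read through `θ.toStage13Params`) served from this lineage's DATUM-GENERIC faces (p509259 `…K2AtBetaOfRecord13ChainFree`) in one line
# each, the two REGISTERED K2⁶ STUB TEXTS ⟺ their jets-free ∕ one-slope forms, and K2⁶'s ∀θ BODY from the jets-free pair and from the chain-free sign-triple

Cell `pub-ymgap`, YM-PLAN Track A (HUMAN RULING D-0062), seat `pub-ymgap-dag-n26-c` (R134 acceleration seat, s2); helper for crux K2⁶ `EndpointGivenBR13SepCoPR` = stmt-QuantumFields-20508 (plan g69 rev 22 commit 2d048f7e82a7, dag-lead WORDS-142 INBOX l.19649; the re-key of K2⁵ stmt-QuantumFields-20295 by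
def-T's KEYMAP v1.6 `Provisos₁₃SepCoP ↦ Provisos₁₃SepCoPR`, `datumOfRecord₁₃SepCoP ↦ datumOfRecord₁₃SepCoPR`, `θ : Stage13Params ↦ Stage13RParams`; director-ym №169 ∕ №174).  = my v1.5 junction
p523730 `…N26AtRecord13SepCoP` ported by token map (№174 (3): pens port their own files).
Trigger (t31′) of this lineage's HANDOFF, per
dag-lead DEDUP-259 (one edition twin per consumer, from the landed text) and plan g67 CORE-YES (consumer faces keyed once, generically; the ITEM texts and registered STUB texts stay
edition-keyed in a thin junction).  Every face below is ONE application of a datum-generic theorem at `hD := βfun_datumOfRecord₁₃SepCoPR` (`rfl`).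

WHAT IS HERE (0 `def`, 0 `sorry`):
* §0 `n26_datumOfRecord₁₃SepCoPR_of_betaContH` — the universal adapter at the edition datum (`βfun_datumOfRecord₁₃SepCoPR`, `rfl`).
* §1 `endpoint_and_n26_datumOfRecord₁₃SepCoPR_of_drift_atSlopeCont` (the registered ∕ jets-free road: p509259 `endpoint_and_n26_of_drift_atSlopeCont₁₃'`),
  `endpoint_and_n26_datumOfRecord₁₃SepCoPR_of_merged_cont_upper_sign` (the chain-free sign-triple: p509259 `endpoint_and_n26_of_merged_cont_upper_sign₁₃`).
* §2 THE TWO REGISTERED K2⁶ STUB TEXTS (plan g69's kit `D69-REV22/rev22/skel/K2Skeleton13SepCoPR.lean` c7cf08d5fca1eab9 for stmt-QuantumFields-20508 = T₆ of g68's registered `K2Skeleton13SepCoP.lean` 2e096938f50cc8ed, `D1AtRecord13` ∕ `D4AtSlopeOfD1Record13` VERBATIM — scratch-checked: the registered defs elaborate as the LHS of the two iffs below) ⟺ their jets-free ∕ one-slope forms: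
  `d1AtRecord13SepCoPR_iff_oneLoopDrift_nonneg` (p505923 §4 under the token map), `d4AtSlopeOfD1Record13SepCoPR_iff_atDrift` (p504252 §4 under the token map).
* §3 K2⁶'s ∀θ BODY (N = 2; no `Theses` import) from ∀θ hypotheses: `k2Consequent₁₃SepCoPR_of_jetsFreePair`, `k2Consequent₁₃SepCoPR_of_chainFreeSign`.

HONEST FRAMING.  Re-keying bookkeeping; nothing of Bałaban's analysis asserted; (D4) INSTANCE 0∕1; `stub_d1Residue13` ∕ `stub_d4AtSlopeCont13` ∕ K2⁶ NOT proved; N25 ∕ N26 NOT discharged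
(N26 VACATED ∕ (D4)-dependent; counts unmoved 5∕27 · A 5∕28); general `N` (§2–§3 at the items' `N = 2`); one finite four-torus programme at fixed ε per run — NOT the continuum limit, NOT ℝ⁴,
NOT OS, NOT a mass gap, NOT Clay.  No `instance`, no `notation`, no `axiom`.
Sources (context): [I] = [Balaban1987RG1] CMP **109** (1987): Thm 2 p. 259 (first sentence), (0.31) p. 259, (1.20)–(1.22) p. 264, (2.12)–(2.14) p. 268; [II] = [Balaban1988RG2Cluster]
CMP **116** (1988): Lemma 3 (2.38) p. 20, (2.41) p. 21; [6] = [Balaban1989LargeFieldII] CMP **122** (1989): Thm 1 + (0.1) pp. 355–356, (1.7)∕(1.9) p. 77.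
-/

noncomputable section

open scoped Matrix.Norms.L2Operator

namespace Summit.QuantumFields.YangMills.Theorems.BalabanUVNodesN26AtRecord13SepCoPR

open Literature.MathematicalPhysics.QuantumFieldTheory.Balaban1983to89
open Literature.MathematicalPhysics.QuantumFieldTheory.Balaban1983to89.FlowStep
open Literature.MathematicalPhysics.QuantumFieldTheory.Balaban1983to89.DagBinding (EndpointExistence)
open Literature.MathematicalPhysics.QuantumFieldTheory.Balaban1983to89.T4Continuum (T4Family FiniteEpsData)
open Literature.MathematicalPhysics.QuantumFieldTheory.Balaban1983to89.Node00
open Literature.MathematicalPhysics.QuantumFieldTheory.Balaban1983to89.Beta.OneStepKernelFamily (TbalOf)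
open Literature.MathematicalPhysics.QuantumFieldTheory.Balaban1983to89.Beta.OneStepResolventKernel (JetData)
open Literature.MathematicalPhysics.QuantumFieldTheory.Balaban1983to89.Beta.Drift (OneLoopDrift)
open Summit.QuantumFields.BalabanUV.Gaps
open Summit.QuantumFields.BalabanUV.Gaps.BetaContFromD4Chain
open Summit.QuantumFields.YangMills.Theorems.BalabanUVNodesK2AtBetaOfRecord13ChainFree
  (endpoint_and_n26_of_drift_atSlopeCont₁₃' endpoint_and_n26_of_merged_cont_upper_sign₁₃)
open Summit.QuantumFields.YangMills.Theorems.BalabanUVNodesK2D1StubJetsFree (exists_datum₁₃_iff_oneLoopDrift_nonneg)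
open Summit.QuantumFields.YangMills.Theorems.BalabanUVNodesN26SlopeOfRecord13 (tendsto_div_beta0_of_pin_residue₁₃)
open Filter Topology

variable (F : T4Family) (N : ℕ) [NeZero N]

/-! ## §0 The adapter at the edition datum -/

section Adapter

variable (θ : Stage13RParams F N)

/-- **THE UNIVERSAL ADAPTER AT THE `SepCoPR` DATUM**: any `BetaContH γ₀ (betaOfRecord₁₃ F N θ.toStage13Params)` face with `0 < γ₀` ⟹ N26's literal at `datumOfRecord₁₃SepCoPR θ hP`
(`βfun_datumOfRecord₁₃SepCoPR`, `rfl`).  Instance 0∕1; N26 NOT discharged. [cite: Balaban1987RG1, (1.20)–(1.22) p.264; Balaban1989LargeFieldII, Thm 1 + (0.1) pp.355–356] -/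
theorem n26_datumOfRecord₁₃SepCoPR_of_betaContH (hP : θ.Provisos₁₃SepCoPR F N) {γ₀ : ℝ} (hγ₀ : 0 < γ₀) (h : BetaContH γ₀ (betaOfRecord₁₃ F N θ.toStage13Params)) :
    ∃ γc : ℝ, 0 < γc ∧ BetaContH γc (datumOfRecord₁₃SepCoPR F N θ hP).βfun :=
  ⟨γ₀, hγ₀, (βfun_datumOfRecord₁₃SepCoPR F N θ hP).symm ▸ h⟩

end Adapter

/-! ## §1 K2⁶'s consequent ∧ N26 at the edition datum: the registered (jets-free) road and the chain-free sign-triple -/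

section AtDatum

variable (θ : Stage13RParams F N)

/-- **★ K2⁶ AT θ FROM THE JETS-FREE PAIR, AT THE `SepCoPR` DATUM** (p509259 `endpoint_and_n26_of_drift_atSlopeCont₁₃'` at `hD := βfun_datumOfRecord₁₃SepCoPR`).  Instance 0∕1; N25 ∕ N26 NOT
discharged. [cite: Balaban1987RG1, Thm 2 p.259 (first sentence), (1.20)–(1.22) p.264 and (2.12)–(2.14) p.268; Balaban1988RG2Cluster, Lemma 3 (2.38) p.20] -/
theorem endpoint_and_n26_datumOfRecord₁₃SepCoPR_of_drift_atSlopeCont (hP : θ.Provisos₁₃SepCoPR F N) {d A γ₀ : ℝ}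
    (hdrift : letI := θ.instVβ₁; letI := θ.instVβ₂; letI := θ.instιβ
      OneLoopDrift d A
        (beta0OfMerged (betaMerged F (mergedTermFamilyMatT F N (TcanOfRecord F N) (chiFixed29 F N θ.ν θ.ε₂₉) θ.εbg) θ.ρ8 θ.bV) θ.v₀))
    (hγ₀ : 0 < γ₀)
    (hres : letI := θ.instVβ₁; letI := θ.instVβ₂; letI := θ.instιβ
      AtSlopeCont
        (oneLoopSplit_betaOfMerged (betaMerged F (mergedTermFamilyMatT F N (TcanOfRecord F N) (chiFixed29 F N θ.ν θ.ε₂₉) θ.εbg) θ.ρ8 θ.bV)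
          (beta0OfMerged (betaMerged F (mergedTermFamilyMatT F N (TcanOfRecord F N) (chiFixed29 F N θ.ν θ.ε₂₉) θ.εbg) θ.ρ8 θ.bV) θ.v₀) θ.γ)
        γ₀ d) :
    EndpointExistence (datumOfRecord₁₃SepCoPR F N θ hP).C.toB12 ∧ ∃ γc : ℝ, 0 < γc ∧ BetaContH γc (datumOfRecord₁₃SepCoPR F N θ hP).βfun :=
  endpoint_and_n26_of_drift_atSlopeCont₁₃' F N θ.toStage13Params _ (βfun_datumOfRecord₁₃SepCoPR F N θ hP) hdrift hγ₀ hres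

/-- **★ K2⁶'s CONSEQUENT ∧ N26 AT THE `SepCoPR` DATUM FROM THE THREE MERGED-β SENTENCES ON A BOX** `]0,γ₀]^{k+1}`, `0 < γ₀ ≤ θ.γ` (p509259 `endpoint_and_n26_of_merged_cont_upper_sign₁₃` at
`hD := βfun_datumOfRecord₁₃SepCoPR`): no `beta0OfMerged`, no split, no jets, no chain.  Instance 0∕1. [cite: Balaban1987RG1, Thm 2 p.259 (first sentence), (0.31) p.259 and (1.20)–(1.22) p.264] -/
theorem endpoint_and_n26_datumOfRecord₁₃SepCoPR_of_merged_cont_upper_sign (hP : θ.Provisos₁₃SepCoPR F N) {γ₀ β' : ℝ} (hγ₀ : 0 < γ₀) (hle : γ₀ ≤ θ.γ)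
    (hβ' : 0 ≤ β')
    (hcont : letI := θ.instVβ₁; letI := θ.instVβ₂; letI := θ.instιβ
      ∀ k, ContinuousOn (betaMerged F (mergedTermFamilyMatT F N (TcanOfRecord F N) (chiFixed29 F N θ.ν θ.ε₂₉) θ.εbg) θ.ρ8 θ.bV k) (Box γ₀ k))
    (hhi : letI := θ.instVβ₁; letI := θ.instVβ₂; letI := θ.instιβ
      ∀ k (v : Fin (k + 1) → ℝ), v ∈ Box γ₀ k →
        betaMerged F (mergedTermFamilyMatT F N (TcanOfRecord F N) (chiFixed29 F N θ.ν θ.ε₂₉) θ.εbg) θ.ρ8 θ.bV k v ≤ β')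
    (hsign : letI := θ.instVβ₁; letI := θ.instVβ₂; letI := θ.instιβ
      ∀ (k : ℕ) (gs : ℕ → ℝ), (∀ i, i ≤ k → 0 < gs i ∧ gs i ≤ γ₀) → (∀ i j, i ≤ j → j ≤ k → gs i ≤ gs j) →
        0 ≤ betaMerged F (mergedTermFamilyMatT F N (TcanOfRecord F N) (chiFixed29 F N θ.ν θ.ε₂₉) θ.εbg) θ.ρ8 θ.bV k (prefixOf gs k)) :
    EndpointExistence (datumOfRecord₁₃SepCoPR F N θ hP).C.toB12 ∧ ∃ γc : ℝ, 0 < γc ∧ BetaContH γc (datumOfRecord₁₃SepCoPR F N θ hP).βfun :=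
  endpoint_and_n26_of_merged_cont_upper_sign₁₃ F N θ.toStage13Params _ (βfun_datumOfRecord₁₃SepCoPR F N θ hP) hγ₀ hle hβ' hcont hhi hsign

end AtDatum

/-! ## §2 The two REGISTERED K2⁶ stub texts ⟺ their jets-free ∕ one-slope forms (token map of p505923 §4 ∕ p504252 §4) -/

section Stubs

/-- **K2⁶'s stub 1 `D1AtRecord13` (plan g69 `K2Skeleton13SepCoPR` c7cf08d5fca1eab9, kit `D69-REV22/rev22/skel/`, stmt-QuantumFields-20508 (rev 22), VERBATIM; `N = 2`) ⟺ «∀ F θ (hP : θ.Provisos₁₃SepCoPR F 2), θ.Admissible F 2 → ∃ d A, 0 ≤ d ∧ OneLoopDrift d A β⁰_θ»**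
(p505923 `exists_datum₁₃_iff_oneLoopDrift_nonneg` per θ; the proviso binder is unused on both sides).  Neither side proved (instance 0∕1). [cite: Balaban1987RG1, (2.12)–(2.13) p.268 and (1.22) p.264] -/
theorem d1AtRecord13SepCoPR_iff_oneLoopDrift_nonneg :
    (∀ (F : T4Family) (θ : Stage13RParams F 2) (hP : θ.Provisos₁₃SepCoPR F 2), θ.Admissible F 2 →
      letI := θ.instVβ₁; letI := θ.instVβ₂; letI := θ.instιβ
      ∃ (Lc : ℕ) (_ : NeZero Lc) (Js : ℕ → JetData 3 Lc) (Nc : ℝ),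
        (∀ j, beta0OfMerged (betaMerged F (mergedTermFamilyMatT F 2 (TcanOfRecord F 2) (chiFixed29 F 2 θ.ν θ.ε₂₉) θ.εbg) θ.ρ8 θ.bV) θ.v₀ j =
            B12Beta.secondMoment (TbalOf Lc Js j) 0 1) ∧
        D1Residue.Residue Lc Js Nc 0 1) ↔
    (∀ (F : T4Family) (θ : Stage13RParams F 2) (hP : θ.Provisos₁₃SepCoPR F 2), θ.Admissible F 2 →
      letI := θ.instVβ₁; letI := θ.instVβ₂; letI := θ.instιβ
      ∃ d A : ℝ, 0 ≤ d ∧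
        OneLoopDrift d A (beta0OfMerged (betaMerged F (mergedTermFamilyMatT F 2 (TcanOfRecord F 2) (chiFixed29 F 2 θ.ν θ.ε₂₉) θ.εbg) θ.ρ8 θ.bV) θ.v₀)) := by
  constructor
  · intro h F θ hP hθ
    exact (exists_datum₁₃_iff_oneLoopDrift_nonneg F 2 θ.toStage13Params).1 (h F θ hP hθ)
  · intro h F θ hP hθ
    exact (exists_datum₁₃_iff_oneLoopDrift_nonneg F 2 θ.toStage13Params).2 (h F θ hP hθ)

/-- **K2⁶'s stub 2 `D4AtSlopeOfD1Record13` (plan g69 `K2Skeleton13SepCoPR` c7cf08d5fca1eab9, kit `D69-REV22/rev22/skel/`, stmt-QuantumFields-20508 (rev 22), VERBATIM; `N = 2`) ⟺ ITS ONE-SLOPE-PER-θ FORM** «at every admissible θ with v1.6 provisos and a (D1) datum,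
`AtSlopeCont` of the record's split at the record's one-loop Cesàro drift» (p504252 §4 under the token map; (⇒) `tendsto_div_beta0_of_pin_residue₁₃` + uniqueness of limits; (⇐)
`d := stepBal Nc Lc`).  Neither side proved (instance 0∕1). [cite: Balaban1987RG1, Thm 2 p.259 (first sentence), (1.20)–(1.22) p.264 and (2.12)–(2.13) p.268; Balaban1988RG2Cluster, Lemma 3 (2.38) p.20] -/
theorem d4AtSlopeOfD1Record13SepCoPR_iff_atDrift :
    (∀ (F : T4Family) (θ : Stage13RParams F 2) (hP : θ.Provisos₁₃SepCoPR F 2), θ.Admissible F 2 →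
      letI := θ.instVβ₁; letI := θ.instVβ₂; letI := θ.instιβ
      ∀ (Lc : ℕ) (_ : NeZero Lc) (Js : ℕ → JetData 3 Lc) (Nc : ℝ),
        (∀ j, beta0OfMerged (betaMerged F (mergedTermFamilyMatT F 2 (TcanOfRecord F 2) (chiFixed29 F 2 θ.ν θ.ε₂₉) θ.εbg) θ.ρ8 θ.bV) θ.v₀ j =
            B12Beta.secondMoment (TbalOf Lc Js j) 0 1) →
        D1Residue.Residue Lc Js Nc 0 1 →
        ∃ γ₀ : ℝ, 0 < γ₀ ∧ γ₀ ≤ θ.γ ∧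
          AtSlopeCont
            (oneLoopSplit_betaOfMerged (betaMerged F (mergedTermFamilyMatT F 2 (TcanOfRecord F 2) (chiFixed29 F 2 θ.ν θ.ε₂₉) θ.εbg) θ.ρ8 θ.bV)
              (beta0OfMerged (betaMerged F (mergedTermFamilyMatT F 2 (TcanOfRecord F 2) (chiFixed29 F 2 θ.ν θ.ε₂₉) θ.εbg) θ.ρ8 θ.bV) θ.v₀) θ.γ)
            γ₀ (B12Normalization.stepBal Nc Lc)) ↔
    (∀ (F : T4Family) (θ : Stage13RParams F 2) (hP : θ.Provisos₁₃SepCoPR F 2), θ.Admissible F 2 →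
      letI := θ.instVβ₁; letI := θ.instVβ₂; letI := θ.instιβ
      ∀ d : ℝ,
        Tendsto (fun k : ℕ => (∑ j ∈ Finset.range k,
          beta0OfMerged (betaMerged F (mergedTermFamilyMatT F 2 (TcanOfRecord F 2) (chiFixed29 F 2 θ.ν θ.ε₂₉) θ.εbg) θ.ρ8 θ.bV) θ.v₀ j) / k) atTop (𝓝 d) →
        (∃ (Lc : ℕ) (_ : NeZero Lc) (Js : ℕ → JetData 3 Lc) (Nc : ℝ),
          (∀ j, beta0OfMerged (betaMerged F (mergedTermFamilyMatT F 2 (TcanOfRecord F 2) (chiFixed29 F 2 θ.ν θ.ε₂₉) θ.εbg) θ.ρ8 θ.bV) θ.v₀ j =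
              B12Beta.secondMoment (TbalOf Lc Js j) 0 1) ∧
          D1Residue.Residue Lc Js Nc 0 1) →
        ∃ γ₀ : ℝ, 0 < γ₀ ∧ γ₀ ≤ θ.γ ∧
          AtSlopeCont
            (oneLoopSplit_betaOfMerged (betaMerged F (mergedTermFamilyMatT F 2 (TcanOfRecord F 2) (chiFixed29 F 2 θ.ν θ.ε₂₉) θ.εbg) θ.ρ8 θ.bV)
              (beta0OfMerged (betaMerged F (mergedTermFamilyMatT F 2 (TcanOfRecord F 2) (chiFixed29 F 2 θ.ν θ.ε₂₉) θ.εbg) θ.ρ8 θ.bV) θ.v₀) θ.γ)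
            γ₀ d) := by
  constructor
  · intro h F θ hP hθ d hd hex
    obtain ⟨Lc, inst, Js, Nc, hβ, hres⟩ := hex
    have hlim := tendsto_div_beta0_of_pin_residue₁₃ F 2 θ.toStage13Params hβ hres
    have hd' : d = B12Normalization.stepBal Nc Lc := tendsto_nhds_unique hd hlim
    rw [hd']
    exact h F θ hP hθ Lc inst Js Nc hβ hres
  · intro h F θ hP hθ Lc inst Js Nc hβ hres
    exact h F θ hP hθ (B12Normalization.stepBal Nc Lc) (tendsto_div_beta0_of_pin_residue₁₃ F 2 θ.toStage13Params hβ hres) ⟨Lc, inst, Js, Nc, hβ, hres⟩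

end Stubs

/-! ## §3 K2⁶'s ∀θ BODY (N = 2) from ∀θ hypotheses: the jets-free pair, and the chain-free sign-triple -/

section Route

/-- **K2⁶'s ∀θ-TEXT (its body verbatim at `N = 2`: v1.6 provisos, unity bundle, admissibility, (B) at the v1.6 datum, the window ⟹ `EndpointExistence`) FROM THE ∀θ JETS-FREE PAIR** «at every
admissible θ with v1.6 provisos: `∃ d A, OneLoopDrift d A β⁰_θ ∧ ∃ γ₀, 0 < γ₀ ∧ γ₀ ≤ θ.γ ∧ AtSlopeCont (split₁₃ θ) γ₀ d`» — EQUIVALENT (with `0 ≤ d`, automatic from a datum) to the two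
registered stubs jointly at each θ (p505923 `registeredPair₁₃_iff_jetsFreePair`); the crux's unity, (B) and window hypotheses unused, as in plan's skeleton.  A REDUCTION: the pair is NOT
proved (instance 0∕1); K2⁶ NOT closed. [cite: Balaban1987RG1, Thm 2 p.259 (first sentence), (1.20)–(1.22) p.264 and (2.12)–(2.14) p.268; Balaban1988RG2Cluster, Lemma 3 (2.38) p.20] -/
theorem k2Consequent₁₃SepCoPR_of_jetsFreePair
    (h : ∀ (F : T4Family) (θ : Stage13RParams F 2) (_ : θ.Provisos₁₃SepCoPR F 2), θ.Admissible F 2 →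
      letI := θ.instVβ₁; letI := θ.instVβ₂; letI := θ.instιβ
      ∃ d A : ℝ,
        OneLoopDrift d A (beta0OfMerged (betaMerged F (mergedTermFamilyMatT F 2 (TcanOfRecord F 2) (chiFixed29 F 2 θ.ν θ.ε₂₉) θ.εbg) θ.ρ8 θ.bV) θ.v₀) ∧
        ∃ γ₀ : ℝ, 0 < γ₀ ∧ γ₀ ≤ θ.γ ∧
          AtSlopeCont
            (oneLoopSplit_betaOfMerged (betaMerged F (mergedTermFamilyMatT F 2 (TcanOfRecord F 2) (chiFixed29 F 2 θ.ν θ.ε₂₉) θ.εbg) θ.ρ8 θ.bV)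
              (beta0OfMerged (betaMerged F (mergedTermFamilyMatT F 2 (TcanOfRecord F 2) (chiFixed29 F 2 θ.ν θ.ε₂₉) θ.εbg) θ.ρ8 θ.bV) θ.v₀) θ.γ)
            γ₀ d) :
    ∀ (F : T4Family) (θ : Stage13RParams F 2) (hP : θ.Provisos₁₃SepCoPR F 2), (θ.ZrUnity F 2 ∧ θ.SlotsNondegenerate₁₃ F 2) → θ.Admissible F 2 →
      B16.EndStatementBPrinted (datumOfRecord₁₃SepCoPR F 2 θ hP).C →
      (∃ γ₁ : ℝ, 0 < γ₁ ∧ ∀ γ : ℝ, 0 < γ → γ ≤ γ₁ → ∃ P : B12.RunParams, 1 ≤ P.K ∧ ((datumOfRecord₁₃SepCoPR F 2 θ hP).C P).flow.InInterval γ P.K) →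
      EndpointExistence (datumOfRecord₁₃SepCoPR F 2 θ hP).C.toB12 := by
  intro F θ hP _ hθ _ _
  obtain ⟨d, A, hdrift, γ₀, hγ₀, -, hres⟩ := h F θ hP hθ
  exact (endpoint_and_n26_datumOfRecord₁₃SepCoPR_of_drift_atSlopeCont F 2 θ hP hdrift hγ₀ hres).1

/-- **K2⁶'s ∀θ-TEXT FROM THE ∀θ MERGED SIGN-TRIPLE** «at every admissible θ with v1.6 provisos, on SOME box `0 < γ₀ ≤ θ.γ` with SOME `β' ≥ 0`: the merged β is per-`k` continuous, `≤ β'`,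
and `≥ 0` at non-decreasing histories» (`…ChainFree` §4's road at the v1.6 datum) — no `beta0OfMerged`, no split, no jets, no chain.  A REDUCTION: the triple is NOT proved (instance 0∕1);
K2⁶ NOT closed. [cite: Balaban1987RG1, Thm 2 p.259 (first sentence), (0.31) p.259 and (1.20)–(1.22) p.264] -/
theorem k2Consequent₁₃SepCoPR_of_chainFreeSign
    (h : ∀ (F : T4Family) (θ : Stage13RParams F 2) (_ : θ.Provisos₁₃SepCoPR F 2), θ.Admissible F 2 →
      letI := θ.instVβ₁; letI := θ.instVβ₂; letI := θ.instιβ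
      ∃ γ₀ β' : ℝ, 0 < γ₀ ∧ γ₀ ≤ θ.γ ∧ 0 ≤ β' ∧
        (∀ k, ContinuousOn (betaMerged F (mergedTermFamilyMatT F 2 (TcanOfRecord F 2) (chiFixed29 F 2 θ.ν θ.ε₂₉) θ.εbg) θ.ρ8 θ.bV k) (Box γ₀ k)) ∧
        (∀ k (v : Fin (k + 1) → ℝ), v ∈ Box γ₀ k →
          betaMerged F (mergedTermFamilyMatT F 2 (TcanOfRecord F 2) (chiFixed29 F 2 θ.ν θ.ε₂₉) θ.εbg) θ.ρ8 θ.bV k v ≤ β') ∧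
        (∀ (k : ℕ) (gs : ℕ → ℝ), (∀ i, i ≤ k → 0 < gs i ∧ gs i ≤ γ₀) → (∀ i j, i ≤ j → j ≤ k → gs i ≤ gs j) →
          0 ≤ betaMerged F (mergedTermFamilyMatT F 2 (TcanOfRecord F 2) (chiFixed29 F 2 θ.ν θ.ε₂₉) θ.εbg) θ.ρ8 θ.bV k (prefixOf gs k))) :
    ∀ (F : T4Family) (θ : Stage13RParams F 2) (hP : θ.Provisos₁₃SepCoPR F 2), (θ.ZrUnity F 2 ∧ θ.SlotsNondegenerate₁₃ F 2) → θ.Admissible F 2 →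
      B16.EndStatementBPrinted (datumOfRecord₁₃SepCoPR F 2 θ hP).C →
      (∃ γ₁ : ℝ, 0 < γ₁ ∧ ∀ γ : ℝ, 0 < γ → γ ≤ γ₁ → ∃ P : B12.RunParams, 1 ≤ P.K ∧ ((datumOfRecord₁₃SepCoPR F 2 θ hP).C P).flow.InInterval γ P.K) →
      EndpointExistence (datumOfRecord₁₃SepCoPR F 2 θ hP).C.toB12 := by
  intro F θ hP _ hθ _ _
  obtain ⟨γ₀, β', hγ₀, hle, hβ', hcont, hhi, hsign⟩ := h F θ hP hθ
  exact (endpoint_and_n26_datumOfRecord₁₃SepCoPR_of_merged_cont_upper_sign F 2 θ hP hγ₀ hle hβ' hcont hhi hsign).1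

end Route


end Summit.QuantumFields.YangMills.Theorems.BalabanUVNodesN26AtRecord13SepCoPR

end
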